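import Summits.FinalStateConjecture.FinalStateConjecture.Theses.ZeroEnergyKerrOrBomb
import Summits.FinalStateConjecture.FinalStateConjecture.Theorems.ZeroEnergyKerrOrBombZeroEnergyRigidityRegularCase
import Summits.FinalStateConjecture.FinalStateConjecture.Theorems.ZeroEnergyKerrOrBombZeroEnergyRigidityStubDocIsometryTransfer
import Summits.FinalStateConjecture.FinalStateConjecture.Theorems.ZeroEnergyKerrOrBombZeroEnergyRigidityStubDocGloballyHyperbolicSet
import Literature.Geometry.Manifold.OpenSubmanifoldMFDeriv

/-!
# Crux `ZeroEnergyRigidity` (stmt-FinalStateConjecture-10690) — line `global-horizon-killing-field`,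
# second lead `c1` (prover-line-stmt-FinalStateConjecture-10690-c1-0): reshaped skeleton
# — adopted verbatim by the third lead `c2` (prover-line-stmt-FinalStateConjecture-10690-c2-0, 2026-08-16T15:30Z)

Lead c2 registers THIS composition unchanged (same seven `stub_*`, same names and signatures, so the registered
stub list of the crux is not forked): S1a is landed (p97727), S1b is c1's pending proposal (p111265), the four
Literature named facts are permanent debts, and S1c `stub_horizonCompletion` is the single open mathematical
stub, held by c1 (optical-completeness line) and audited adversarially by c2 (landability of its `∃ 𝓑'`
conclusion; doc-intrinsic reshapes; the glue facts `[T,K] = 0`, completeness of `K`, `κ > 0`).  Original header: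


The first lineage's registered skeleton (gen 2, 2026-08-16T10:23Z) has ONE open mathematical stub,
S1 `stub_regularRepresentation` (h1–h4 ⇒ an `I⁺`-regular vacuum RE-PRESENTATION of the d.o.c. with a
complete `T`-commuting horizon Killing field), plus four Literature debts.  This reshape splits S1:

* S1a `stub_docGloballyHyperbolicSet` — h4 ⇒ the d.o.c. is a globally hyperbolic SET (Hawking–Ellis
  §6.6; the second clause of Chruściel–Costa's Def. 1.1): PROVABLE NOW (causal convexity of
  `I⁺(M_ext) ∩ I⁻(M_ext)` by push-up, compact diamonds and strong causality from h4);
* S1b `stub_futurePresentation` — WLOG FUTURE-PRESENTED: h1–h4 ⇒ a presentation `𝓑⁺` carried by the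
  open sub-carrier `I⁺(M_ext)` with h1–h4, every point in `I⁺(M_ext⁺)`, and a `T`-equivariant smooth
  injective isometric immersion `ι : 𝓑⁺ → 𝓑` onto `I⁺(M_ext)` mapping `M_ext⁺, doc⁺, 𝓔⁺⁺` onto
  `M_ext, doc, 𝓔⁺`: PROVABLE NOW (L; template `CauchyDevelopmentRestrict.restrict`);
* S1c `stub_horizonCompletion` — the RESIDUE: a future-presented presentation with h1–h4 and globally
  hyperbolic d.o.c. admits the `I⁺`-regular re-presentation of S1.  OPEN (horizon completion; held by
  the lead) — all non-classical content of the typed crux sits here.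

`stub_regularRepresentation` (the first lineage's S1, same statement) is then a THEOREM of S1a–S1c
(`regularRepresentation_of`), and `ZeroEnergyRigidity_of` concludes the route decl BY NAME exactly as
before, through the landed `RegularCase.stub_kerrConclusion_of_regular` (p89982) and
`DocIsometryTransfer.stub_docIsometryTransfer` (p79890).  `sorry` occurs only in the seven `stub_*`.
-/

noncomputable section

-- `Summit.FinalStateConjecture.FinalStateConjecture.…`: summit = problem name (single-conjunct summit, D-0017).
set_option linter.dupNamespace false

namespace Summit.FinalStateConjecture.FinalStateConjecture.Theorems.ZeroEnergyRigidity.GlobalHorizonKillingField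

open Set Function Literature.Geometry.Lorentzian
open scoped Manifold ContDiff Topology
open Summit.FinalStateConjecture.FinalStateConjecture.Theses.ZeroEnergyKerrOrBomb (ZeroEnergyRigidity)

/-! ## The six open stubs (`sorry` lives only here; statements over tree vocabulary only)

S1a `stub_docGloballyHyperbolicSet` is LANDED (p97727, `…StubDocGloballyHyperbolicSet.lean`, imported). -/

/-- **Stub S1b · futurePresentation (provable now, L).**  WLOG the carrier is `I⁺(M_ext)`: a vacuum
presentation with connected non-degenerate horizon and globally hyperbolic carrier restricts to the
open, connected, `T`-invariant, causally convex sub-carrier `I⁺(M_ext)` as a presentation `𝓑⁺` with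
the same four hypotheses, FUTURE-PRESENTED (`𝓑⁺ = I⁺(M_ext⁺)`), together with a smooth injective
isometric immersion `ι : 𝓑⁺ → 𝓑` (the inclusion) with range `I⁺(M_ext)`, intertwining the
stationary fields and mapping `M_ext⁺` into `M_ext` (the re-presentation's `M_ext⁺` is generated by a
farther slice piece, so only `⊆`; its chronological future and past are those of `M_ext`) and
`⟨⟨M_ext⁺⟩⟩`, `𝓔⁺(𝓑⁺)` ONTO `⟨⟨M_ext⟩⟩`, `𝓔⁺`.  (Reshaped 12:45Z: `⊆` for the `M_ext` clause.) -/
theorem stub_futurePresentation :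
    ∀ (𝓑 : StationaryAFBlackHole.{0}) [𝓑.metric.HasLeviCivita],
      𝓑.metric.toPseudoRiemannianMetric.IsRicciFlat → IsConnected 𝓑.horizon →
      𝓑.toSpacetime.IsNonDegenerateHorizon 𝓑.Mext →
      𝓑.metric.IsGloballyHyperbolic 𝓑.timeOrientation →
        ∃ (𝓑' : StationaryAFBlackHole.{0}) (_ : 𝓑'.metric.HasLeviCivita),
          𝓑'.metric.toPseudoRiemannianMetric.IsRicciFlat ∧ IsConnected 𝓑'.horizon ∧
          𝓑'.toSpacetime.IsNonDegenerateHorizon 𝓑'.Mext ∧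
          𝓑'.metric.IsGloballyHyperbolic 𝓑'.timeOrientation ∧
          (∀ p : 𝓑'.carrier, p ∈ 𝓑'.metric.chronologicalFuture 𝓑'.timeOrientation 𝓑'.Mext) ∧
          ∃ ι : 𝓑'.carrier → 𝓑.carrier, Function.Injective ι ∧
            Set.range ι = 𝓑.metric.chronologicalFuture 𝓑.timeOrientation 𝓑.Mext ∧
            PseudoRiemannianMetric.IsIsometricImmersion 𝓑'.metric.toPseudoRiemannianMetric
              𝓑.metric.toPseudoRiemannianMetric ι ∧
            (∀ x, mfderiv (𝓡 4) (𝓡 4) ι x (𝓑'.killing x) = 𝓑.killing (ι x)) ∧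
            ι '' 𝓑'.Mext ⊆ 𝓑.Mext ∧ ι '' 𝓑'.doc = 𝓑.doc ∧ ι '' 𝓑'.horizon = 𝓑.horizon := by
  sorry

/-- **Stub S1c · horizonCompletion (the residue; OPEN; held by the lead).**  A FUTURE-PRESENTED vacuum
presentation (`𝓑 = I⁺(M_ext)`) with connected non-degenerate horizon (global Killing generator `K`,
`κ ≠ 0`), globally hyperbolic carrier and globally hyperbolic d.o.c. admits an `I⁺`-REGULAR vacuum
re-presentation `𝓑'` (Chruściel–Costa 2008, Def. 1.1) with connected horizon, carrying a Killing field
`K'` which is complete, commutes with `T'`, is nowhere zero on and tangent to `𝓔⁺'` with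
`∇_{K'} K' = κ K'` there (`κ ≠ 0`), whose d.o.c. (open submanifold, restricted metric) is carried by a
smooth injective isometric immersion `Θ` onto `𝓑.doc`.  Content: completion of the d.o.c. along the
missing horizon generators (compact cross-sections, Chruściel–Costa hypersurface `S̄`); not in print. -/
theorem stub_horizonCompletion :
    ∀ (𝓑 : StationaryAFBlackHole.{0}) [𝓑.metric.HasLeviCivita],
      𝓑.metric.toPseudoRiemannianMetric.IsRicciFlat → IsConnected 𝓑.horizon →
      𝓑.toSpacetime.IsNonDegenerateHorizon 𝓑.Mext →
      𝓑.metric.IsGloballyHyperbolic 𝓑.timeOrientation →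
      𝓑.toSpacetime.IsGloballyHyperbolicSet 𝓑.doc →
      (∀ p : 𝓑.carrier, p ∈ 𝓑.metric.chronologicalFuture 𝓑.timeOrientation 𝓑.Mext) →
        ∃ (𝓑' : StationaryAFBlackHole.{0}) (_ : 𝓑'.metric.HasLeviCivita),
          𝓑'.metric.toPseudoRiemannianMetric.IsRicciFlat ∧ 𝓑'.IsIPlusRegular ∧
          IsConnected 𝓑'.horizon ∧
          (∃ K' : Π x : 𝓑'.carrier, TangentSpace (𝓡 4) x,
            𝓑'.metric.IsKillingField K' ∧ IsCompleteVectorField K' ∧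
            (∀ x, VectorField.mlieBracket (𝓡 4) 𝓑'.killing K' x = 0) ∧
            (∀ p ∈ 𝓑'.horizon, K' p ≠ 0) ∧
            (∀ γ : ℝ → 𝓑'.carrier, IsMIntegralCurve γ K' → γ 0 ∈ 𝓑'.horizon →
              ∀ t, γ t ∈ 𝓑'.horizon) ∧
            ∃ κ : ℝ, κ ≠ 0 ∧ ∀ p ∈ 𝓑'.horizon, 𝓑'.metric.leviCivita K' p (K' p) = κ • K' p) ∧
          ∃ Θ : 𝓑'.docOpens LorentzianMetric.isOpen_chronologicalFuture_holds_of_boundaryless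
              LorentzianMetric.isOpen_chronologicalPast_holds_of_boundaryless → 𝓑.carrier,
            Function.Injective Θ ∧ Set.range Θ = 𝓑.doc ∧
            PseudoRiemannianMetric.IsIsometricImmersion
              (𝓑'.metric.restrict PseudoRiemannianMetric.contMDiff_restrict_holds
                (𝓑'.docOpens LorentzianMetric.isOpen_chronologicalFuture_holds_of_boundaryless
                  LorentzianMetric.isOpen_chronologicalPast_holds_of_boundaryless)).toPseudoRiemannianMetric
              𝓑.metric.toPseudoRiemannianMetric Θ := by
  sorry

/-- **Stub · sudarskyWaldStaticity** (Literature named fact; Sudarsky–Wald 1993 + Chruściel–Wald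
1994: a non-rotating `I⁺`-regular vacuum hole is static on its d.o.c.). -/
theorem stub_sudarskyWaldStaticity : SudarskyWald1993_staticity := by
  sorry

/-- **Stub · docStaticUniqueness** (Literature named fact; Chruściel–Galloway 2010 /
Chruściel–Costa–Heusler 2012, Thm. 3.1: static `I⁺`-regular vacuum d.o.c. is Schwarzschild). -/
theorem stub_docStaticUniqueness : ChruscielGalloway2010_docStaticUniqueness := by
  sorry

/-- **Stub · beigChruscielCombination** (Literature named fact; Beig–Chruściel 1997, Thm. 1.2:
a second complete commuting Killing field combines with `T` to a `2π`-periodic axial field). -/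
theorem stub_beigChruscielCombination : BeigChrusciel1997_axisymmetricCombination.{0} := by
  sorry

/-- **Stub · cchAxisymmetricUniqueness** (Literature named fact; Chruściel–Costa–Heusler 2012,
Thm. 3.2: `I⁺`-regular stationary axisymmetric vacuum hole with connected non-degenerate horizon
is Kerr — no analyticity). -/
theorem stub_cchAxisymmetricUniqueness : ChruscielCostaHeusler2012_axisymmetricUniqueness.{0} := by
  sorry

/-! ## Compositions (kernel-checked, no `sorry` outside the stubs) -/

/-- The inclusion of the d.o.c. (open submanifold, restricted metric) of a presentation is a smooth
isometric immersion (the differential of the inclusion of an open submanifold is the identity). -/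
theorem isIsometricImmersion_doc_val (𝓑 : StationaryAFBlackHole.{0}) :
    PseudoRiemannianMetric.IsIsometricImmersion
      (𝓑.metric.restrict PseudoRiemannianMetric.contMDiff_restrict_holds
        (𝓑.docOpens LorentzianMetric.isOpen_chronologicalFuture_holds_of_boundaryless
          LorentzianMetric.isOpen_chronologicalPast_holds_of_boundaryless)).toPseudoRiemannianMetric
      𝓑.metric.toPseudoRiemannianMetric Subtype.val := by
  refine ⟨contMDiff_subtype_val, fun x ↦ ?_⟩
  ext v w
  rw [pullbackBilin_apply, Literature.Geometry.Manifold.OpenSubmanifold.mfderiv_subtype_val]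
  rfl

/-- **S1 from S1a–S1c** (`regularRepresentation_of`): the first lineage's stub
`stub_regularRepresentation`, same statement, is a theorem of the reshaped stubs — restrict to the
future-presented sub-carrier `I⁺(M_ext)` (S1b), whose d.o.c. is a globally hyperbolic set (S1a),
complete the horizon there (S1c), and compose the two d.o.c. isometries (the inclusion of
`⟨⟨M_ext⁺⟩⟩` followed by `ι`, then `DocIsometryTransfer.exists_isIsometricImmersion_of_range_eq`). -/
theorem regularRepresentation_of :
    ∀ (𝓑 : StationaryAFBlackHole.{0}) [𝓑.metric.HasLeviCivita],
      𝓑.metric.toPseudoRiemannianMetric.IsRicciFlat → IsConnected 𝓑.horizon →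
      𝓑.toSpacetime.IsNonDegenerateHorizon 𝓑.Mext →
      𝓑.metric.IsGloballyHyperbolic 𝓑.timeOrientation →
        ∃ (𝓑' : StationaryAFBlackHole.{0}) (_ : 𝓑'.metric.HasLeviCivita),
          𝓑'.metric.toPseudoRiemannianMetric.IsRicciFlat ∧ 𝓑'.IsIPlusRegular ∧
          IsConnected 𝓑'.horizon ∧
          (∃ K' : Π x : 𝓑'.carrier, TangentSpace (𝓡 4) x,
            𝓑'.metric.IsKillingField K' ∧ IsCompleteVectorField K' ∧
            (∀ x, VectorField.mlieBracket (𝓡 4) 𝓑'.killing K' x = 0) ∧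
            (∀ p ∈ 𝓑'.horizon, K' p ≠ 0) ∧
            (∀ γ : ℝ → 𝓑'.carrier, IsMIntegralCurve γ K' → γ 0 ∈ 𝓑'.horizon →
              ∀ t, γ t ∈ 𝓑'.horizon) ∧
            ∃ κ : ℝ, κ ≠ 0 ∧ ∀ p ∈ 𝓑'.horizon, 𝓑'.metric.leviCivita K' p (K' p) = κ • K' p) ∧
          ∃ Θ : 𝓑'.docOpens LorentzianMetric.isOpen_chronologicalFuture_holds_of_boundaryless
              LorentzianMetric.isOpen_chronologicalPast_holds_of_boundaryless → 𝓑.carrier,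
            Function.Injective Θ ∧ Set.range Θ = 𝓑.doc ∧
            PseudoRiemannianMetric.IsIsometricImmersion
              (𝓑'.metric.restrict PseudoRiemannianMetric.contMDiff_restrict_holds
                (𝓑'.docOpens LorentzianMetric.isOpen_chronologicalFuture_holds_of_boundaryless
                  LorentzianMetric.isOpen_chronologicalPast_holds_of_boundaryless)).toPseudoRiemannianMetric
              𝓑.metric.toPseudoRiemannianMetric Θ := by
  intro 𝓑 _ h1 h2 h3 h4
  obtain ⟨𝓑₁, inst₁, h1₁, h2₁, h3₁, h4₁, hfp₁, ι, hιinj, -, hιiso, -, -, hιdoc, -⟩ :=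
    stub_futurePresentation 𝓑 h1 h2 h3 h4
  haveI := inst₁
  obtain ⟨𝓑', inst', h1', hreg', hconn', hK', Θ₁, hΘ₁inj, hΘ₁range, hΘ₁iso⟩ :=
    stub_horizonCompletion 𝓑₁ h1₁ h2₁ h3₁ h4₁ (DocGloballyHyperbolicSet.stub_docGloballyHyperbolicSet 𝓑₁ h4₁) hfp₁
  -- the d.o.c. isometry of `𝓑₁` into `𝓑`: the inclusion of `⟨⟨M_ext₁⟩⟩` followed by `ι`
  set U₁ := 𝓑₁.docOpens LorentzianMetric.isOpen_chronologicalFuture_holds_of_boundaryless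
    LorentzianMetric.isOpen_chronologicalPast_holds_of_boundaryless with hU₁
  have hΘ₂inj : Function.Injective (ι ∘ (Subtype.val : U₁ → 𝓑₁.carrier)) :=
    hιinj.comp Subtype.val_injective
  have hΘ₂iso : PseudoRiemannianMetric.IsIsometricImmersion
      (𝓑₁.metric.restrict PseudoRiemannianMetric.contMDiff_restrict_holds U₁).toPseudoRiemannianMetric
      𝓑.metric.toPseudoRiemannianMetric (ι ∘ (Subtype.val : U₁ → 𝓑₁.carrier)) :=
    hιiso.comp (isIsometricImmersion_doc_val 𝓑₁)
  have hΘ₂range : Set.range (ι ∘ (Subtype.val : U₁ → 𝓑₁.carrier)) = 𝓑.doc := by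
    rw [Set.range_comp, Subtype.range_coe_subtype, ← hιdoc]
    rfl
  obtain ⟨Θ, hΘinj, hΘrange, hΘiso⟩ :=
    DocIsometryTransfer.exists_isIsometricImmersion_of_range_eq
      PseudoRiemannianMetric.contMDiff_restrict_holds U₁ hΘ₂inj hΘ₂iso hΘ₁inj hΘ₁range hΘ₁iso
  exact ⟨𝓑', inst', h1', hreg', hconn', hK', Θ, hΘinj, hΘrange.trans hΘ₂range, hΘiso⟩

/-- **The skeleton theorem**: the seven stubs imply the crux `ZeroEnergyRigidity` BY NAME — S1a–S1c
re-present (`regularRepresentation_of`), the landed regular-case dichotomy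
(`RegularCase.stub_kerrConclusion_of_regular`, fed with the four named facts) gives the Kerr chart
conclusion for the re-presentation, and the landed transport S5
(`DocIsometryTransfer.stub_docIsometryTransfer`) carries it back along `Θ`.  Hypotheses h5 and h6 of
the typed crux are not used (both are theorems under h4, `Negative.zeroEnergyRigidity_iff_core`). -/
theorem ZeroEnergyRigidity_of : ZeroEnergyRigidity := by
  intro 𝓑 _ _ h1 h2 h3 h4 _h5 _h6
  obtain ⟨𝓑', inst', h1', hreg', hconn', hK', hΘ⟩ := regularRepresentation_of 𝓑 h1 h2 h3 h4
  haveI := inst'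
  exact DocIsometryTransfer.stub_docIsometryTransfer 𝓑 𝓑' hΘ
    (RegularCase.stub_kerrConclusion_of_regular stub_sudarskyWaldStaticity stub_docStaticUniqueness
      stub_cchAxisymmetricUniqueness stub_beigChruscielCombination 𝓑' h1' hreg' hconn' hK')

end Summit.FinalStateConjecture.FinalStateConjecture.Theorems.ZeroEnergyRigidity.GlobalHorizonKillingField

end
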